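import Summits.Ventures.PercRepro.ProfilePointedCircuitClassesStarSharpV

/-!
# PercRepro — CASE D0 OF `StarNineSharp`, PART A: WHEN NO RANK-3 SET THROUGH `e` IS ON, THE `b′`-AVOIDING
TWO-POINT INEQUALITY HOLDS (p5, gen 54; `proofs/P5-GM1.md` §81 (c), the «no ON demand» sub-regime)

Write `E₇ := E − b − b′`, `𝒲 := BI_4(N)`.  The inequality of `StarNineSharp` at `(e, f)` is
`#{W ∈ 𝒲 : e ∈ W ∌ f, b′ ∉ W} ≤ #{W ∈ 𝒲 : f ∈ W, b′ ∉ W}` (`inCount_thru_split'`).  A demand `W` is OFF when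
`(E ∖ W) − b′ ∈ 𝒲`; the OFF demands inject into the targets avoiding `e` by `W ↦ (E ∖ W) − b′` (StarSharpV's
`compl_erase_mem_of_subset_E7'` / `compl_erase_erase'`).  An ON demand contains `b` and is `Y + b` with `Y ⊆ E₇` a
rank-`3` set through `e` with `ρ(Y ∪ {b, b′}) = 4` (`demand_on_data`).  So when every rank-`3` subset of `E₇` through
`e` has `ρ(Y ∪ {b, b′}) = 5` (no ON plane of `R = N ∖ {b, b′}` contains `e` — the modular cut of `b` avoids `e`;
this covers the free extension, every cut generated by planes avoiding `e`, and 66,589 of the 191,842 D0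
configurations of the catalogue) there is no ON demand and the OFF injection alone proves the inequality:
**`inCount_thru_le_of_no_on_through_e`**, and its instance `starNineSharp_instance_of_no_on_through_e`.
-/

open scoped Matroid

namespace PercRepro.Cogirth

open Finset ThmH Skew Shadow Profile

variable {α : Type} [DecidableEq α] {N : Matroid α} [N.Finite]

section StarSharpD0A

variable {b b' : α}

/-- **THE DATA OF AN ON DEMAND**: a demand `W` (`e ∈ W ∌ f`, `b′ ∉ W`) whose complement-minus-`b′` is not
bi-independent contains `b`, and `Y := W − b ⊆ E₇` is a `3`-set through `e` avoiding `f` with `ρ(Y) = 3`,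
`ρ(E₇ ∖ Y) = 4` and `ρ(Y ∪ {b, b′}) = 4`. -/
theorem demand_on_data (h : SeriesPair N b b') (hn : (gr N).card = 9) {e f : α} (heb : e ≠ b)
    {W : Finset α} (hWs : W ∈ biIndepSets N 4) (hPD : (e ∈ W ∧ f ∉ W) ∧ b' ∉ W)
    (hcW : ¬ (gr N \ W).erase b' ∈ biIndepSets N 4) :
    b ∈ W ∧ W.erase b ⊆ ((gr N).erase b).erase b' ∧ e ∈ W.erase b ∧ f ∉ W.erase b ∧ (W.erase b).card = 3 ∧
      rk N (W.erase b) = 3 ∧ rk N (((gr N).erase b).erase b' \ W.erase b) = 4 ∧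
      rk N (insert b (insert b' (W.erase b))) = 4 := by
  have hb : b ∈ gr N := h.1; have hb' : b' ∈ gr N := h.2.1; have hbb' : b ≠ b' := h.2.2.1
  have hE7c : (((gr N).erase b).erase b').card = 7 := by
    rw [card_erase_of_mem (mem_erase.2 ⟨hbb'.symm, hb'⟩), card_erase_of_mem hb, hn]
  have hbW : b ∈ W := by
    by_contra hbW
    exact hcW (compl_erase_mem_of_subset_E7' h hn hWs hbW hPD.2)
  obtain ⟨hWg, hW4, -, -⟩ := mem_biIndepSets.1 hWs
  have hYE : W.erase b ⊆ ((gr N).erase b).erase b' := by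
    intro x hx
    rw [mem_erase] at hx
    exact mem_erase.2 ⟨fun h' => hPD.2 (h' ▸ hx.2), mem_erase.2 ⟨hx.1, hWg hx.2⟩⟩
  have hY3 : (W.erase b).card = 3 := by rw [card_erase_of_mem hbW, hW4]
  have hW' : insert b (W.erase b) ∈ biIndepSets N 4 := by rw [insert_erase hbW]; exact hWs
  obtain ⟨hYr, hYc⟩ := (insert_b_mem_biIndepSets_iff h hn hYE hY3).1 hW'
  refine ⟨hbW, hYE, mem_erase.2 ⟨heb, hPD.1.1⟩, fun h' => hPD.1.2 (mem_of_mem_erase h'), hY3, hYr, hYc, ?_⟩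
  have e1 : (gr N \ W).erase b' = ((gr N).erase b).erase b' \ W.erase b := by
    ext x
    simp only [mem_erase, mem_sdiff, not_and]
    constructor
    · rintro ⟨hxb', hxg, hxW⟩
      exact ⟨⟨hxb', fun h' => hxW (h' ▸ hbW), hxg⟩, fun _ => hxW⟩
    · rintro ⟨⟨hxb', hxb, hxg⟩, hxW⟩
      exact ⟨hxb', hxg, fun h' => hxW hxb h'⟩
  have hYc' : (((gr N).erase b).erase b' \ W.erase b).card = 4 := by
    rw [card_sdiff_of_subset hYE, hE7c, hY3]
  rw [e1, mem_biIndepSets_iff_of_subset_E7 h hn sdiff_subset hYc', Finset.sdiff_sdiff_eq_self hYE, hYc] at hcW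
  have h4 : rk N (insert b (W.erase b)) = 4 := by
    rw [rk_insert_left_eq_add_one_of_seriesPair h hYE, hYr]
  have h5 : rk N (insert b (insert b' (W.erase b))) ≤ rk N (insert b (W.erase b)) + 1 := by
    have e2 : insert b (insert b' (W.erase b)) = insert b' (insert b (W.erase b)) := by
      ext x; simp only [mem_insert]; tauto
    rw [e2]
    exact rk_insert_le_add_one hb' (insert_subset hb (hYE.trans ((erase_subset _ _).trans (erase_subset _ _))))
  have h6 : rk N (insert b (W.erase b)) ≤ rk N (insert b (insert b' (W.erase b))) :=
    rk_mono' (M := N) (insert_subset_insert b (subset_insert b' _))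
  have : ¬ rk N (insert b (insert b' (W.erase b))) = 5 := fun h' => hcW ⟨rfl, h'⟩
  omega

/-- **THE OFF INJECTION** (the first map of StarSharpU/V, isolated): the OFF demands inject into the OFF targets
avoiding `e` by `W ↦ (E ∖ W) − b′`. -/
theorem card_off_demands_le {e f : α} (hf : f ∈ gr N) (hfb' : f ≠ b') :
    ((biIndepSets N 4).filter (fun W => ((e ∈ W ∧ f ∉ W) ∧ b' ∉ W) ∧ (gr N \ W).erase b' ∈ biIndepSets N 4)).card ≤
      ((biIndepSets N 4).filter (fun W => (f ∈ W ∧ b' ∉ W) ∧ (e ∉ W ∧ (gr N \ W).erase b' ∈ biIndepSets N 4))).card := by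
  apply card_le_card_of_injOn (fun W => (gr N \ W).erase b')
  · intro W hW
    simp only [mem_coe, mem_filter] at hW ⊢
    obtain ⟨hWs, ⟨⟨heW, hfW⟩, hb'W⟩, hcW⟩ := hW
    refine ⟨hcW, ⟨mem_erase.2 ⟨hfb', mem_sdiff.2 ⟨hf, hfW⟩⟩, fun h' => (mem_erase.1 h').1 rfl⟩,
      fun h' => (mem_sdiff.1 (mem_of_mem_erase h')).2 heW, ?_⟩
    rw [compl_erase_erase' hWs hb'W]
    exact hWs
  · intro W₁ hW₁ W₂ hW₂ heq
    simp only [mem_coe, mem_filter] at hW₁ hW₂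
    have e1 := compl_erase_erase' hW₁.1 hW₁.2.1.2
    have e2 := compl_erase_erase' hW₂.1 hW₂.2.1.2
    have heq' : (gr N \ W₁).erase b' = (gr N \ W₂).erase b' := heq
    rw [← e1, ← e2, heq']

/-- **NO ON DEMAND ⟹ THE INEQUALITY**: if every `3`-subset `Y` of `E₇ = E − b − b′` through `e` with `ρ(Y) = 3` has
`ρ(Y ∪ {b, b′}) = 5` (no plane of `N ∖ {b, b′}` through `e` lies in the modular cut of `b`), then
`in_4(e) + thru_4({b′,f}) + thru_4({b′,e,f}) ≤ in_4(f) + thru_4({e,f}) + thru_4({b′,e})`. -/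
theorem inCount_thru_le_of_no_on_through_e (hn : (gr N).card = 9) (h : SeriesPair N b b') {e f : α}
    (hf : f ∈ gr N) (heb : e ≠ b) (hfb' : f ≠ b')
    (hoff : ∀ Y : Finset α, Y ⊆ ((gr N).erase b).erase b' → e ∈ Y → Y.card = 3 → rk N Y = 3 →
      rk N (insert b (insert b' Y)) = 5) :
    inCount N 4 e + thruCount N 4 {b', f} + thruCount N 4 {b', e, f} ≤
      inCount N 4 f + thruCount N 4 {e, f} + thruCount N 4 {b', e} := by
  rw [inCount_thru_split']
  have hsplit := card_filter_add_card_filter_not (s := (biIndepSets N 4).filter (fun W => (e ∈ W ∧ f ∉ W) ∧ b' ∉ W))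
    (fun W => (gr N \ W).erase b' ∈ biIndepSets N 4)
  simp only [filter_filter] at hsplit
  have hnone : ((biIndepSets N 4).filter (fun W => ((e ∈ W ∧ f ∉ W) ∧ b' ∉ W) ∧
      ¬ (gr N \ W).erase b' ∈ biIndepSets N 4)).card = 0 := by
    rw [card_eq_zero, filter_eq_empty_iff]
    intro W hWs hW
    obtain ⟨hPD, hcW⟩ := hW
    obtain ⟨-, hYE, heY, -, hY3, hYr, -, hYon⟩ := demand_on_data h hn heb hWs hPD hcW
    have := hoff _ hYE heY hY3 hYr
    omega
  have hinj := card_off_demands_le (N := N) (b' := b') (e := e) hf hfb'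
  have hle : ((biIndepSets N 4).filter (fun W => (f ∈ W ∧ b' ∉ W) ∧ (e ∉ W ∧ (gr N \ W).erase b' ∈ biIndepSets N 4))).card ≤
      ((biIndepSets N 4).filter (fun W => f ∈ W ∧ b' ∉ W)).card := by
    apply card_le_card
    intro W hW
    simp only [mem_filter] at hW ⊢
    exact ⟨hW.1, hW.2.1⟩
  omega

/-- The instance of `StarNineSharp` in the «no ON plane through `e`» regime, with the Prop's hypotheses. -/
theorem starNineSharp_instance_of_no_on_through_e (hn : (gr N).card = 9) {b b' e f : α} (h : SeriesPair N b b')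
    (hf : f ∈ gr N) (heb : e ≠ b) (hfb' : f ≠ b')
    (hoff : ∀ Y : Finset α, Y ⊆ ((gr N).erase b).erase b' → e ∈ Y → Y.card = 3 → rk N Y = 3 →
      rk N (insert b (insert b' Y)) = 5) :
    inCount N 4 e + thruCount N 4 {b', f} + thruCount N 4 {b', e, f} ≤
      inCount N 4 f + thruCount N 4 {e, f} + thruCount N 4 {b', e} :=
  inCount_thru_le_of_no_on_through_e hn h hf heb hfb' hoff

end StarSharpD0A

end PercRepro.Cogirth
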